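import Literature.Barriers.CriticalPhenomena.SAPAnisotropicNotDFiniteProofs
import HarnessLib

/-!
# Rechnitzer's Theorem 16 reduced to its 2-4-2 inputs: Lemma 26 and the final induction of
# *Haruspicy 2*, §3.4, proved; the 2-4-2 polygon facts (Lemma 20, Lemma 25/eq. (33), eq. (38))
# vendored as named facts

Topic `Literature/Barriers/CriticalPhenomena`; second companion of `SAPAnisotropicNotDFinite`
(A. Rechnitzer, *Haruspicy 2: The anisotropic generating function of self-avoiding polygons is
not D-finite*, J. Combin. Theory Ser. A 113 (2006) 520–546; numbering of arXiv:math/0406450v2).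
The barrier `SAPAnisotropicNotDFinite = ¬ IsDFiniteInY (sapAnisotropicGF ℂ)` is Corollary 27; the
first companion `SAPAnisotropicNotDFiniteProofs` proves Theorem 15 and
`thm1 → thm16 → Corollary 27`, so that the barrier rests on the named facts `Rechnitzer2006_thm1`
(every row `H_n` is rational) and `Rechnitzer2006_thm16` (for `k ≠ 2`, `H_{3k-2}` has a simple
pole at the zeros of `Ψ_k`).

This file opens up Theorem 16 along the printed proof (§3.2–§3.4, arXiv pp. 8–12), whose
architecture is:

1. (§3.2, Lemmas 17, 19, 20) the `Ψ_k`-singular part of `H_{3k-2}` is that of the generating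
   function `f_k(1;x)` of **2-4-2 polygons** (Definition 18: numbering the rows of a polygon from
   the top, the numbers of vertical bonds per row are `(2,4,2,…,4,2)`) with `6k-4` vertical bonds:
   the other polygons of `𝒫_{3k-2}` have a horizontal half-perimeter generating function whose
   denominator "is a product of cyclotomic polynomials `Ψ_j(x)` for `j` strictly less than `k`"
   (proof of Lemma 17, by Theorems 1, 6, 12 and Lemma 19 — the haruspicy of §2);
2. (§3.3, Lemmas 21–25) with `s` conjugate to the width of the bottom row, the generating
   functions `f_n(s;x)` of 2-4-2 polygons with `6n-4` vertical bonds satisfy `f_1 = sx/(1-sx)`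
   (eq. (33)) and a recurrence `f_{n+1}(s;x) = Σ_{j≤5} c_{j+1} ∂ˢʲf_n(1;x) + c_7 f_n(s;x) +
   c_8 f_n(sx;x)` (eq. (34); eq. (35) at `s = 1`) obtained from a Hadamard-product construction,
   of whose coefficients only the denominators and
   `c_8 = -2sx²(s²x²+sx-s+1)/((1-sx)⁴(1-x)²)` are printed (eq. (31));
3. (§3.4) writing `g_{n,k}(x) = f_k(x^{n-k};x)`: `g_{n,1} = xⁿ/(1-xⁿ)`, and for `2 ≤ k ≤ n`
   (eq. (38), from eq. (32) and the recurrence; at `k = n` because `ĉ_8 = c_8|_{s=1}`)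
   `g_{n,k} = N(x^{n-k};x)/D(x^{n-k};x) + c_8(x^{n-k};x) g_{n,k-1}` with `D(x^{n-k};x)` a
   product of cyclotomic polynomials `Ψ_i`, `i ≤ n-1`; **Lemma 26**: on `|x| = 1`,
   `c_8(xʲ;x)` vanishes only at `x = -1` (`j` even); hence by induction on `k`, `g_{n,k}` is
   singular at every primitive `n`-th root of unity for `n ≠ 2`, in particular
   `f_n(1;x) = g_{n,n}` is, and by step 1 so is `H_{3n-2}` — Theorem 16 (pole part).

What is PROVED here: Lemma 26 (`Rechnitzer2006_lem26`), the induction of step 3 for any family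
of power series satisfying the two displayed identities (`mem_poleSet_of_recurrence242`), the
passage from step 1 to the poles of `H_{3k-2}` and the assembly
`sapAnisotropicNotDFinite_of_thm1_242 : thm1 → lem25_f1 → eq38 → lem20 → SAPAnisotropicNotDFinite`
(with Theorem 15 and the accumulation-point argument of the first companion). What is VENDORED
as named facts, on new definitions of the 2-4-2 counts in the rooted-walk model of the fact file
(`polygonBonds`, `yMin`, `yMax`, `rowVerticalBonds`, `Is242`, `bottomWidth`, `rooted242Count`,
`p242Count`, `sap242GF K k j = f_k(xʲ;x)`): `Rechnitzer2006_lem25_f1` (eq. (33) specialised: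
2-4-2 polygons with two vertical bonds are the unit-height rectangles), `Rechnitzer2006_eq38`
(step 3's recurrence, cleared of denominators, with the printed `c_8`) and `Rechnitzer2006_lem20`
(step 1). The simplicity of the pole (the other half of Theorem 16, from Corollary 13) is not
needed for Corollary 27 and is not addressed. Discharging `lem25_f1` is elementary but needs the
`2N`-to-one correspondence between rooted walks and polygons for rectangles; `eq38` needs
Lemmas 21–25 (the coefficients `c_1,…,c_7` would have to be recomputed from `T̂`); `lem20` needs
the haruspicy theory of §2 (sections, pages, section-minimal polygons). The value of `c_8` was
re-derived by hand from the printed `T̂` of Lemma 21 (coefficient of `1/(1-stx)` in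
`T(t/x,s;x,y)/y⁴`) and agrees with eq. (31) and with `ĉ_8 = -2x³(1+x)/(1-x)⁶`.

## References

* A. Rechnitzer, *Haruspicy 2: The anisotropic generating function of self-avoiding polygons is
  not D-finite*, J. Combin. Theory Ser. A 113 (2006) 520–546, arXiv:math/0406450: Definition 18,
  Lemmas 17, 19, 20, 21, 23, 24, 25, 26, eqs. (29)–(38), proof of Theorem 16, Corollary 27.
  [Rechnitzer2006Haruspicy2]
* N. Madras, G. Slade, *The Self-Avoiding Walk*, Birkhäuser 1993: Definition 3.2.1, eq. (3.2.1)
  (rooted walks vs polygons, `2N`-to-one). [MadrasSlade1993]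
-/

noncomputable section

open Finset Filter Topology PowerSeries Literature.Probability.LatticeModels
open scoped BigOperators Polynomial

namespace Literature.Barriers.CriticalPhenomena

/-! ### 2-4-2 polygons in the rooted-walk model (Rechnitzer 2006, Definition 18) -/

/-- The bonds of the rooted oriented polygon attached to a walk `ω : 0 → e` on `ℤ²` (`e` a
neighbour of `0`): the darts of `ω` as ordered pairs of sites, together with the closing bond
`(e, 0)`; every vertex of the polygon is the first component of exactly one of them.
[cite: MadrasSlade1993, Definition 3.2.1] -/
def polygonBonds {e : Site 2} (ω : (zdGraph 2).Walk (0 : Site 2) e) : List (Site 2 × Site 2) :=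
  (e, 0) :: ω.darts.map SimpleGraph.Dart.toProd

/-- The lowest ordinate of a vertex of a rooted polygon given by its list of bonds (the root `0`
has ordinate `0`, whence the initial value). [cite: Rechnitzer2006Haruspicy2, Definition 18] -/
def yMin (L : List (Site 2 × Site 2)) : ℤ :=
  (L.map fun b => b.1 1).foldr min 0

/-- The highest ordinate of a vertex of a rooted polygon given by its list of bonds.
[cite: Rechnitzer2006Haruspicy2, Definition 18] -/
def yMax (L : List (Site 2 × Site 2)) : ℤ :=
  (L.map fun b => b.1 1).foldr max 0

/-- `v_r`: the number of VERTICAL bonds of the polygon in the cell row `r`, i.e. bonds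
`{(c, r), (c, r+1)}` (same abscissa, lower ordinate `r`) — the vertical bonds crossed by the
horizontal line `y = r + ½`. [cite: Rechnitzer2006Haruspicy2, Definition 18] -/
def rowVerticalBonds (L : List (Site 2 × Site 2)) (r : ℤ) : ℕ :=
  L.countP fun b => b.1 0 = b.2 0 ∧ min (b.1 1) (b.2 1) = r

/-- **2-4-2 polygons** (Rechnitzer 2006, Definition 18): "Number the rows of a polygon `P`
starting from the topmost row (row `1`) to the bottommost (row `r`). Let `v_i(P)` be the number
of vertical bonds in the `i`th row of `P`. If `(v_1(P), …, v_r(P)) = (2,4,2,…,4,2)` then we call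
`P` a 2-4-2 polygon"; "this set is empty unless `2n = 6k-4`", i.e. `r = 2k - 1` rows, `k` rows
with `2` and `k - 1` rows with `4` vertical bonds. Here for the bond list of a rooted polygon and
the parameter `k ≥ 1`: the polygon spans exactly the `2k-1` cell rows `yMin, …, yMax - 1` and the
`i`-th of them from the bottom (`i = 0, …, 2k-2`; the pattern is symmetric) carries `2` vertical
bonds for even `i` and `4` for odd `i`. (`k = 0` is a junk parameter: no polygon qualifies.)
[cite: Rechnitzer2006Haruspicy2, Definition 18] -/
def Is242 (k : ℕ) (L : List (Site 2 × Site 2)) : Prop :=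
  yMax L - yMin L = ((2 * k - 1 : ℕ) : ℤ) ∧
    ∀ i : ℕ, i < 2 * k - 1 → rowVerticalBonds L (yMin L + i) = if Even i then 2 else 4

/-- The width ("length") of the bottom row of a polygon: the number of horizontal bonds on its
lowest line `y = yMin`. For a 2-4-2 polygon the bottom cell row carries two vertical bonds, so
the vertices of lowest ordinate form a single segment and this is the number of cells of the
bottom row, the statistic conjugate to `s` in `f(s;x,y)`.
[cite: Rechnitzer2006Haruspicy2, Lemma 23] -/
def bottomWidth (L : List (Site 2 × Site 2)) : ℕ :=
  L.countP fun b => b.1 1 = yMin L ∧ b.2 1 = yMin L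

open Classical in
/-- `2N` times the number of 2-4-2 polygons (up to translation) with `6k-4` vertical bonds
(`k ≥ 1`), `2m` horizontal bonds and bottom row of width `w`, `N = 2(m + 3k - 2)` the number of
bonds: as in `rootedPolygonCount`, the pairs (`e` a neighbour of `0`, `ω` an `(N-1)`-step
self-avoiding walk from `0` to `e`) whose polygon `ω ∪ {e,0}` has these statistics — which
translation, re-rooting and orientation preserve, so that each polygon is counted exactly `2N`
times; `0` when `N < 4`. [cite: Rechnitzer2006Haruspicy2, Definition 18]
[cite: MadrasSlade1993, Definition 3.2.1 and eq. (3.2.1)] -/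
def rooted242Count (k m w : ℕ) : ℕ :=
  if m + (3 * k - 2) < 2 then 0 else
    ∑ e ∈ (zdGraph 2).neighborFinset 0,
      (((zdGraph 2).finsetWalkLength (2 * (m + (3 * k - 2)) - 1) (0 : Site 2) e).filter
        fun p => p.IsPath ∧ horizontalSteps p + (if e 1 = 0 then 1 else 0) = 2 * m ∧
          Is242 k (polygonBonds p) ∧ bottomWidth (polygonBonds p) = w).card

/-- The number of 2-4-2 polygons on `ℤ²` up to translation with `6k-4` vertical bonds,
horizontal half-perimeter `m` and bottom row of width `w` (so `w ≤ m`), i.e. the coefficient of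
`s^w x^m` in Rechnitzer's `f_k(s;x)`, the generating function of `𝒫^{242}_{3k-2}`.
[cite: Rechnitzer2006Haruspicy2, Definition 18 and Lemma 25] -/
def p242Count (k m w : ℕ) : ℕ :=
  rooted242Count k m w / (2 * (2 * (m + (3 * k - 2))))

/-- `f_k(xʲ;x) = Σ_{m,w} p^{242}_k(m,w) x^{m + jw}`: the generating function of the 2-4-2
polygons with `6k-4` vertical bonds by horizontal half-perimeter, with the bottom-row variable
`s` specialised to `xʲ` (the series `f_k(x^{n-k};x)` of the proof of Theorem 16; `j = 0` gives
`f_k(1;x)`, the horizontal half-perimeter generating function of `𝒫^{242}_{3k-2}`). The inner sum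
is finite because `w ≤ m`. [cite: Rechnitzer2006Haruspicy2, Lemma 25 and §3.4, eq. (38)] -/
def sap242GF (K : Type*) [Semiring K] (k j : ℕ) : PowerSeries K :=
  PowerSeries.mk fun M => ∑ w ∈ range (M + 1),
    if j * w ≤ M then (p242Count k (M - j * w) w : K) else 0

/-- Change of coefficients in `f_k(xʲ;x)`: its coefficients are natural numbers.
[cite: Rechnitzer2006Haruspicy2, Definition 18] -/
theorem map_sap242GF {K L : Type*} [CommSemiring K] [CommSemiring L] (f : K →+* L) (k j : ℕ) :
    PowerSeries.map f (sap242GF K k j) = sap242GF L k j := by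
  ext M
  simp [sap242GF, coeff_map, coeff_mk, map_sum, apply_ite f]

/-! ### The coefficient `c_8` and Lemma 26 -/

/-- `p_j(x) = x^{2j+2} + x^{j+1} - xʲ + 1`, the numerator factor of `c_8(xʲ;x)`
(`c_8(s;x) = -2sx²(s²x²+sx-s+1)/((1-sx)⁴(1-x)²)`, eq. (31), at `s = xʲ`).
[cite: Rechnitzer2006Haruspicy2, eq. (31) and Lemma 26] -/
def lem26Poly (j : ℕ) : ℚ[X] :=
  Polynomial.X ^ (2 * j + 2) + Polynomial.X ^ (j + 1) - Polynomial.X ^ j + 1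

/-- `2x^{j+2} p_j(x)`: minus the numerator of `c_8(xʲ;x)`.
[cite: Rechnitzer2006Haruspicy2, eq. (31) and Lemma 26] -/
def c8Num (j : ℕ) : ℚ[X] :=
  2 * Polynomial.X ^ (j + 2) * lem26Poly j

/-- `(1 - x^{j+1})⁴ (1 - x)²`: the denominator of `c_8(xʲ;x)`, so that
`c_8(xʲ;x) = - c8Num j / c8Den j`. [cite: Rechnitzer2006Haruspicy2, eq. (31) and Lemma 26] -/
def c8Den (j : ℕ) : ℚ[X] :=
  (1 - Polynomial.X ^ (j + 1)) ^ 4 * (1 - Polynomial.X) ^ 2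

/-- **Rechnitzer 2006, Lemma 26**: "When `s = xᵏ`, `c_8(xᵏ,x)` has a single zero on the unit
circle at `x = -1` when `k` is even. When `k` is odd `c_8(xᵏ,x)` has no zeros on the unit
circle." Precisely (the printed proof): a point `z` of the unit circle is a zero of
`p_j(x) = x^{2j+2} + x^{j+1} - xʲ + 1` iff `z = -1` and `j` is even. (Printed argument: dividing
by `z^{j+1}`, `z̄ - 1 = 2 Re(z^{j+1})` is real, so `z = ±1`; `p_j(1) = 2`, `p_j(-1) = 2 ∓ 2`.)
[cite: Rechnitzer2006Haruspicy2, Lemma 26] -/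
theorem Rechnitzer2006_lem26 {z : ℂ} (hz : ‖z‖ = 1) (j : ℕ) :
    z ^ (2 * j + 2) + z ^ (j + 1) - z ^ j + 1 = 0 ↔ z = -1 ∧ Even j := by
  constructor
  · intro hp
    set w : ℂ := (starRingEnd ℂ) z with hw
    have h1 : z * w = 1 := by
      rw [hw, Complex.mul_conj, Complex.normSq_eq_norm_sq, hz]
      simp
    have hpw : w ^ (2 * j + 2) + w ^ (j + 1) - w ^ j + 1 = 0 := by
      have := congr_arg (starRingEnd ℂ) hp
      simpa [hw, map_add, map_sub, map_pow] using this
    have e1 : (z * w) ^ (2 * j + 2) = 1 := by rw [h1, one_pow]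
    have e2 : (z * w) ^ (j + 1) = 1 := by rw [h1, one_pow]
    have e3 : (z * w) ^ j = 1 := by rw [h1, one_pow]
    have key : z ^ j * (z ^ 2 - 1) = 0 := by
      linear_combination hp - z ^ (2 * j + 2) * hpw + e1 + z ^ (j + 1) * e2 - z ^ (j + 2) * e3
    have hz0 : z ≠ 0 := by
      rintro rfl
      simp at hz
    rcases mul_eq_zero.mp key with h | h
    · exact absurd (pow_eq_zero_iff'.mp h).1 hz0
    · rcases sq_eq_one_iff.mp (sub_eq_zero.mp h) with rfl | rfl
      · norm_num at hp
      · refine ⟨rfl, ?_⟩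
        by_contra hodd
        rw [Nat.not_even_iff_odd] at hodd
        have h2 : (-1 : ℂ) ^ (2 * j + 2) = 1 := by
          rw [show 2 * j + 2 = 2 * (j + 1) by ring, pow_mul]
          norm_num
        have h3 : (-1 : ℂ) ^ (j + 1) = 1 := (Nat.even_add_one.mpr (Nat.not_even_iff_odd.mpr hodd)).neg_one_pow
        rw [h2, h3, hodd.neg_one_pow] at hp
        norm_num at hp
  · rintro ⟨rfl, hj⟩
    have h2 : (-1 : ℂ) ^ (2 * j + 2) = 1 := by
      rw [show 2 * j + 2 = 2 * (j + 1) by ring, pow_mul]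
      norm_num
    have h3 : (-1 : ℂ) ^ (j + 1) = -1 := hj.add_one.neg_one_pow
    rw [h2, h3, hj.neg_one_pow]
    ring

/-- Lemma 26 at a primitive `n`-th root of unity `ξ`, `n ≠ 2` (so `ξ ≠ -1`): `p_j(ξ) ≠ 0`, hence
`c_8(xʲ;x)` does not vanish at `ξ` — the form in which Lemma 26 enters the proof of Theorem 16
("`c_8(x^{n-k};x)` is non-zero at `x = ξ`, except when `n = k = 2`").
[cite: Rechnitzer2006Haruspicy2, Lemma 26 and proof of Theorem 16] -/
theorem eval_map_c8Num_ne_zero {n : ℕ} (hn : n ≠ 0) (hn2 : n ≠ 2) {ξ : ℂ}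
    (hξ : IsPrimitiveRoot ξ n) (j : ℕ) : ((c8Num j).map (algebraMap ℚ ℂ)).eval ξ ≠ 0 := by
  have hnorm : ‖ξ‖ = 1 := hξ.norm'_eq_one hn
  have hξ0 : ξ ≠ 0 := by
    rintro rfl
    simp at hnorm
  have hp : ξ ^ (2 * j + 2) + ξ ^ (j + 1) - ξ ^ j + 1 ≠ 0 := by
    intro h
    obtain ⟨rfl, -⟩ := (Rechnitzer2006_lem26 hnorm j).mp h
    have h2 : IsPrimitiveRoot (-1 : ℂ) 2 :=
      ⟨by norm_num, fun l hl => even_iff_two_dvd.mp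
        ((neg_one_pow_eq_one_iff_even (by norm_num)).mp hl)⟩
    exact hn2 (hξ.unique h2)
  have : ((c8Num j).map (algebraMap ℚ ℂ)).eval ξ =
      2 * ξ ^ (j + 2) * (ξ ^ (2 * j + 2) + ξ ^ (j + 1) - ξ ^ j + 1) := by
    simp [c8Num, lem26Poly]
  rw [this]
  exact mul_ne_zero (mul_ne_zero two_ne_zero (pow_ne_zero _ hξ0)) hp

/-- A product of cyclotomic polynomials `Ψ_i` with all `i ≠ n` does not vanish at a primitive
`n`-th root of unity (`Ψ_i(ξ) = 0` iff `ξ` is a primitive `i`-th root; `Ψ_0 = 1`). [folklore] -/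
theorem eval_map_prod_cyclotomic_ne_zero {n : ℕ} {ξ : ℂ} (hξ : IsPrimitiveRoot ξ n)
    (t : Multiset ℕ) (ht : ∀ i ∈ t, i ≠ n) :
    (((t.map fun i => Polynomial.cyclotomic i ℚ).prod).map (algebraMap ℚ ℂ)).eval ξ ≠ 0 := by
  rw [Polynomial.map_multiset_prod, Polynomial.eval_multiset_prod, Multiset.map_map,
    Multiset.map_map, Ne, Multiset.prod_eq_zero_iff, Multiset.mem_map]
  rintro ⟨i, hi, h0⟩
  simp only [Function.comp_apply, Polynomial.map_cyclotomic] at h0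
  rcases Nat.eq_zero_or_pos i with rfl | hi0
  · simp at h0
  · haveI : NeZero (i : ℂ) := ⟨by exact_mod_cast hi0.ne'⟩
    exact ht i hi (hξ.unique (Polynomial.isRoot_cyclotomic_iff.mp h0)).symm

/-! ### Named facts: the 2-4-2 inputs of the proof of Theorem 16 -/

/-- **Rechnitzer 2006, Lemma 25, eq. (33)** (specialised at `s = xʲ`, as used in §3.4: "If we
set `k = 1`, then we see that `f_1(x^{n-1};x) = xⁿ/(1-xⁿ)`"): the 2-4-2 polygons with two
vertical bonds are the rectangles of unit height, one of each width `w ≥ 1`, of horizontal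
half-perimeter `w` ("for `n = 1` all configurations are rectangles", §1), so
`f_1(s;x) = sx/(1-sx)` and `(1 - x^{j+1}) f_1(xʲ;x) = x^{j+1}`. Elementary, but its discharge
needs the `2N`-to-one count of the rooted walks around a `1 × w` rectangle.
[cite: Rechnitzer2006Haruspicy2, Lemma 25, eq. (33)] -/
def Rechnitzer2006_lem25_f1 : Prop :=
  ∀ j : ℕ, (1 - X ^ (j + 1)) * sap242GF ℚ 1 j = X ^ (j + 1)

/-- **Rechnitzer 2006, proof of Theorem 16, eq. (38)** (with eq. (32) and eq. (31)): for
`2 ≤ k ≤ n`, "`f_k(x^{n-k};x) = N(x^{n-k};x)/D(x^{n-k};x) + c_8(x^{n-k};x) f_{k-1}(x^{n-k+1};x)`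
… and we note that `D(x^{n-k};x) ∈ ℂ_{n-1}(x)`" (a product of cyclotomic polynomials `Ψ_i(x)`,
`1 ≤ i ≤ n-1`; `N(s;x)` a polynomial; "In the case `k = n` the above equation is still true,
since `ĉ_8 = c_8|_{s=1}`"), where `c_8(s;x) = -2sx²(s²x²+sx-s+1)/((1-sx)⁴(1-x)²)` (eq. (31)),
i.e. `c_8(xʲ;x) = -c8Num j/c8Den j`. Cleared of denominators, with `j = n - k`:
`D · (c8Den j · f_k(xʲ;x) + c8Num j · f_{k-1}(x^{j+1};x)) = N · c8Den j` in `ℚ⟦x⟧`. This is the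
output of the Hadamard-product recurrence of Lemmas 21–25 (whose coefficients `c_1, …, c_7` are
not printed) together with the denominator form (32); it is the only place where they enter the
proof of Theorem 16. [cite: Rechnitzer2006Haruspicy2, §3.4, proof of Theorem 16, eq. (38)] -/
def Rechnitzer2006_eq38 : Prop :=
  ∀ n k : ℕ, 2 ≤ k → k ≤ n → ∃ (N : ℚ[X]) (t : Multiset ℕ), (∀ i ∈ t, 1 ≤ i ∧ i < n) ∧
    ((t.map fun i => Polynomial.cyclotomic i ℚ).prod : PowerSeries ℚ) *
        ((c8Den (n - k) : PowerSeries ℚ) * sap242GF ℚ k (n - k) +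
          (c8Num (n - k) : PowerSeries ℚ) * sap242GF ℚ (k - 1) (n - k + 1)) =
      (N * c8Den (n - k) : ℚ[X])

/-- **Rechnitzer 2006, Lemma 20** ("The factor `Ψ_k(x)` appears in the denominator of the
generating function `Σ_{P ∈ 𝒫^{242}_{3k-2}} x^{|P|_⇔}` with exponent exactly equal to `1` if and
only if it appears in the denominator of `H_{3k-2}(x)` with exponent exactly equal to one"), in the
form established by its proof ("Similar to the proof of Lemma 17": the polygons of `𝒫_{3k-2}` that
are not 2-4-2 form a dense set containing no section-minimal polygon with a `K`-section,
`k ∣ K`, so by Theorems 1 and 6 "the denominator of the horizontal half-perimeter generating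
function of this set is a product of cyclotomic polynomials `Ψ_j(x)` for `j` strictly less than
`k`"): for `k ≥ 1` there are `N ∈ ℚ[x]` and `D` a product of `Ψ_j`, `j < k`, with
`D · (H_{3k-2} - f_k(1;x)) = N`. This is the haruspicy input (§2: sections, pages,
section-minimal polygons, Theorems 6 and 12, Lemma 19).
[cite: Rechnitzer2006Haruspicy2, Lemma 20 (and proof of Lemma 17)] -/
def Rechnitzer2006_lem20 : Prop :=
  ∀ k : ℕ, 1 ≤ k → ∃ (N : ℚ[X]) (t : Multiset ℕ), (∀ i ∈ t, i < k) ∧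
    ((t.map fun i => Polynomial.cyclotomic i ℚ).prod : PowerSeries ℚ) *
        (sapRowGF ℚ (3 * k - 2) - sap242GF ℚ k 0) = N

/-! ### The induction of §3.4 -/

/-- **The final induction of the proof of Theorem 16** (Rechnitzer 2006, §3.4), for an arbitrary
family `G k j ∈ ℚ⟦x⟧` in place of `f_k(xʲ;x)`: if `(1 - x^{j+1}) G_1^{(j)} = x^{j+1}` and, for
`2 ≤ k ≤ n`, `D (c8Den_{n-k} G_k^{(n-k)} + c8Num_{n-k} G_{k-1}^{(n-k+1)}) = N c8Den_{n-k}` with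
`D` a product of `Ψ_i`, `1 ≤ i < n`, then for `n ≠ 2` and every primitive `n`-th root of unity
`ξ`, each `G_k^{(n-k)}`, `1 ≤ k ≤ n`, has a pole at `ξ` over `ℂ` (every denominator vanishes at
`ξ`). Printed argument: `G_1^{(n-1)} = xⁿ/(1-xⁿ)` is singular at `ξ`; if `G_k^{(n-k)}` had a
denominator `E` with `E(ξ) ≠ 0`, then `E · D · c8Num_{n-k}` would be one for `G_{k-1}^{(n-k+1)}`,
and it does not vanish at `ξ` by Lemma 26 (`ξ ≠ -1` as `n ≠ 2`) — contradiction.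
[cite: Rechnitzer2006Haruspicy2, §3.4, proof of Theorem 16] -/
theorem mem_poleSet_of_recurrence242 (G : ℕ → ℕ → PowerSeries ℚ)
    (h1 : ∀ j : ℕ, (1 - X ^ (j + 1)) * G 1 j = X ^ (j + 1))
    (hrec : ∀ n k : ℕ, 2 ≤ k → k ≤ n → ∃ (N : ℚ[X]) (t : Multiset ℕ), (∀ i ∈ t, 1 ≤ i ∧ i < n) ∧
      ((t.map fun i => Polynomial.cyclotomic i ℚ).prod : PowerSeries ℚ) *
          ((c8Den (n - k) : PowerSeries ℚ) * G k (n - k) +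
            (c8Num (n - k) : PowerSeries ℚ) * G (k - 1) (n - k + 1)) =
        (N * c8Den (n - k) : ℚ[X]))
    {n : ℕ} (hn : 1 ≤ n) (hn2 : n ≠ 2) {ξ : ℂ} (hξ : IsPrimitiveRoot ξ n) :
    ∀ k, 1 ≤ k → k ≤ n → ξ ∈ poleSet (PowerSeries.map (algebraMap ℚ ℂ) (G k (n - k))) := by
  set φ := algebraMap ℚ ℂ with hφ
  have hξ0 : ξ ≠ 0 := by
    intro h
    have := hξ.norm'_eq_one (by omega)
    rw [h, norm_zero] at this
    exact zero_ne_one this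
  intro k hk
  induction k with
  | zero => exact absurd hk (by omega)
  | succ k ih =>
    intro hkn
    rcases Nat.lt_or_ge k 1 with hk1 | hk1
    · -- base case `k + 1 = 1`: `(1 - xⁿ) G = xⁿ`
      obtain rfl : k = 0 := by omega
      have hb := congr_arg (PowerSeries.map φ) (h1 (n - 1))
      rw [map_mul, show n - 1 + 1 = n by omega] at hb
      rintro E ⟨-, M, hEM⟩
      have hb' : (((1 - Polynomial.X ^ n : ℚ[X]).map φ : ℂ[X]) : PowerSeries ℂ) *
          PowerSeries.map φ (G 1 (n - 1)) = ((Polynomial.X ^ n : ℚ[X]).map φ : ℂ[X]) := by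
        simpa [Polynomial.polynomial_map_coe] using hb
      have hx := cross_mul_eq hEM hb'
      have hx' := congr_arg (Polynomial.eval ξ) hx
      simp only [Polynomial.eval_mul, Polynomial.eval_map, Polynomial.eval₂_sub,
        Polynomial.eval₂_one, Polynomial.eval₂_X_pow, hξ.pow_eq_one, sub_self, zero_mul,
        mul_one] at hx'
      exact hx'.symm
    · -- induction step `k → k + 1`, `2 ≤ k + 1 ≤ n`
      have ih' := ih hk1 (by omega)
      obtain ⟨N, t, ht, hid⟩ := hrec n (k + 1) (by omega) hkn
      rw [Nat.add_sub_cancel, show n - (k + 1) + 1 = n - k by omega] at hid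
      set j := n - (k + 1) with hj
      set D : ℚ[X] := (t.map fun i => Polynomial.cyclotomic i ℚ).prod with hD
      rintro E ⟨hE0, M, hEM⟩
      by_contra hEξ
      -- map the identity to `ℂ`
      have hidC := congr_arg (PowerSeries.map φ) hid
      rw [map_mul, map_add, map_mul, map_mul] at hidC
      simp only [← Polynomial.polynomial_map_coe] at hidC
      set A := PowerSeries.map φ (G (k + 1) j) with hA
      set B := PowerSeries.map φ (G k (n - k)) with hB
      -- the new denominator of `B`
      have hden : IsDenom B (E * D.map φ * (c8Num j).map φ) := by
        have hDξ : (D.map φ).eval ξ ≠ 0 :=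
          eval_map_prod_cyclotomic_ne_zero hξ t fun i hi => (ht i hi).2.ne
        have hPξ : ((c8Num j).map φ).eval ξ ≠ 0 := eval_map_c8Num_ne_zero (by omega) hn2 hξ j
        refine ⟨mul_ne_zero (mul_ne_zero hE0 fun h => hDξ (by simp [h]))
          fun h => hPξ (by simp [h]), E * N.map φ * (c8Den j).map φ - D.map φ * (c8Den j).map φ * M,
          ?_⟩
        have e1 : ((E * D.map φ * (c8Num j).map φ : ℂ[X]) : PowerSeries ℂ) =
            (E : PowerSeries ℂ) * (D.map φ : ℂ[X]) * ((c8Num j).map φ : ℂ[X]) := by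
          simp [Polynomial.coe_mul]
        have e2 : ((E * N.map φ * (c8Den j).map φ - D.map φ * (c8Den j).map φ * M : ℂ[X]) :
              PowerSeries ℂ) =
            (E : PowerSeries ℂ) * (N.map φ : ℂ[X]) * ((c8Den j).map φ : ℂ[X]) -
              (D.map φ : ℂ[X]) * ((c8Den j).map φ : ℂ[X]) * (M : PowerSeries ℂ) := by
          simp [Polynomial.coe_mul, Polynomial.coe_sub]
        have hidC' : ((D.map φ : ℂ[X]) : PowerSeries ℂ) *
            ((((c8Den j).map φ : ℂ[X]) : PowerSeries ℂ) * A +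
              (((c8Num j).map φ : ℂ[X]) : PowerSeries ℂ) * B) =
            ((N.map φ : ℂ[X]) : PowerSeries ℂ) * (((c8Den j).map φ : ℂ[X]) : PowerSeries ℂ) := by
          simpa [Polynomial.map_mul, Polynomial.coe_mul] using hidC
        rw [e1, e2]
        linear_combination (E : PowerSeries ℂ) * hidC' -
          ((D.map φ : ℂ[X]) : PowerSeries ℂ) * (((c8Den j).map φ : ℂ[X]) : PowerSeries ℂ) * hEM
      have hroot := ih' _ hden
      simp only [Polynomial.IsRoot.def, Polynomial.eval_mul, mul_eq_zero] at hroot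
      rcases hroot with (h | h) | h
      · exact hEξ h
      · exact eval_map_prod_cyclotomic_ne_zero hξ t (fun i hi => (ht i hi).2.ne) h
      · exact eval_map_c8Num_ne_zero (by omega) hn2 hξ j h

/-! ### Theorem 16 (pole part) and the barrier from the 2-4-2 facts -/

/-- Step 3 of the printed proof: `f_n(1;x)` (the generating function of `𝒫^{242}_{3n-2}`) is
singular at every primitive `n`-th root of unity, `n ≥ 1`, `n ≠ 2`, given eq. (33) and eq. (38).
[cite: Rechnitzer2006Haruspicy2, §3.4, proof of Theorem 16] -/
theorem mem_poleSet_sap242GF (hf1 : Rechnitzer2006_lem25_f1) (h38 : Rechnitzer2006_eq38)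
    {n : ℕ} (hn : 1 ≤ n) (hn2 : n ≠ 2) {ξ : ℂ} (hξ : IsPrimitiveRoot ξ n) :
    ξ ∈ poleSet (sap242GF ℂ n 0) := by
  have := mem_poleSet_of_recurrence242 (fun k j => sap242GF ℚ k j) hf1 h38 hn hn2 hξ n hn le_rfl
  rwa [Nat.sub_self, map_sap242GF] at this

/-- **Theorem 16, pole part, from the 2-4-2 facts**: for `k ≥ 1`, `k ≠ 2`, every primitive
`k`-th root of unity is a pole of `H_{3k-2}` over `ℂ` (a zero of each of its denominators):
by Lemma 20, `D (H_{3k-2} - f_k(1;x))` is a polynomial with `D(ξ) ≠ 0`, so a denominator of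
`H_{3k-2}` not vanishing at `ξ` would give one of `f_k(1;x)`.
[cite: Rechnitzer2006Haruspicy2, Theorem 16 and Lemma 20] -/
theorem mem_poleSet_sapRowGF_of_242 (hf1 : Rechnitzer2006_lem25_f1) (h38 : Rechnitzer2006_eq38)
    (h20 : Rechnitzer2006_lem20) {k : ℕ} (hk : 1 ≤ k) (hk2 : k ≠ 2) {ξ : ℂ}
    (hξ : IsPrimitiveRoot ξ k) : ξ ∈ poleSet (sapRowGF ℂ (3 * k - 2)) := by
  set φ := algebraMap ℚ ℂ with hφ
  obtain ⟨N, t, ht, hid⟩ := h20 k hk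
  set D : ℚ[X] := (t.map fun i => Polynomial.cyclotomic i ℚ).prod with hD
  have hDξ : (D.map φ).eval ξ ≠ 0 :=
    eval_map_prod_cyclotomic_ne_zero hξ t fun i hi => (ht i hi).ne
  have hidC := congr_arg (PowerSeries.map φ) hid
  rw [map_mul, map_sub, map_sapRowGF, map_sap242GF, ← Polynomial.polynomial_map_coe,
    ← Polynomial.polynomial_map_coe] at hidC
  rintro E ⟨hE0, M, hEM⟩
  by_contra hEξ
  have hden : IsDenom (sap242GF ℂ k 0) (E * D.map φ) := by
    refine ⟨mul_ne_zero hE0 fun h => hDξ (by simp [h]), D.map φ * M - E * N.map φ, ?_⟩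
    rw [Polynomial.coe_mul, Polynomial.coe_sub, Polynomial.coe_mul, Polynomial.coe_mul, ← hEM]
    linear_combination (-(E : PowerSeries ℂ)) * hidC
  have hroot := mem_poleSet_sap242GF hf1 h38 hk hk2 hξ _ hden
  simp only [Polynomial.IsRoot.def, Polynomial.eval_mul, mul_eq_zero] at hroot
  rcases hroot with h | h
  · exact hEξ h
  · exact hDξ h

/-- From a pole over `ℂ` at a primitive `k`-th root of unity back to the language of
`Rechnitzer2006_thm16`: every denominator `D ∈ ℚ[x]` of a series `H ∈ ℚ⟦x⟧` whose base change has
a pole at `ξ` is divisible by `Ψ_k`, the minimal polynomial of `ξ` over `ℚ`. [folklore] -/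
theorem cyclotomic_dvd_of_mem_poleSet {H : PowerSeries ℚ} {N D : ℚ[X]} (hD : D ≠ 0)
    (h : (D : PowerSeries ℚ) * H = N) {k : ℕ} (hk : 1 ≤ k) {ξ : ℂ} (hξ : IsPrimitiveRoot ξ k)
    (hpole : ξ ∈ poleSet (PowerSeries.map (algebraMap ℚ ℂ) H)) :
    Polynomial.cyclotomic k ℚ ∣ D := by
  have hden : IsDenom (PowerSeries.map (algebraMap ℚ ℂ) H) (D.map (algebraMap ℚ ℂ)) := by
    refine ⟨(Polynomial.map_ne_zero_iff (algebraMap ℚ ℂ).injective).mpr hD,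
      N.map (algebraMap ℚ ℂ), ?_⟩
    rw [Polynomial.polynomial_map_coe, Polynomial.polynomial_map_coe, ← map_mul, h]
  have hroot := hpole _ hden
  rw [Polynomial.cyclotomic_eq_minpoly_rat hξ hk]
  refine minpoly.dvd ℚ ξ ?_
  rwa [Polynomial.IsRoot.def, Polynomial.eval_map, ← Polynomial.aeval_def] at hroot

/-- **The `Ψ_k ∣ D` half of `Rechnitzer2006_thm16`** from Theorem 1 and the 2-4-2 facts: for
`k ≥ 1`, `k ≠ 2`, in lowest terms `H_{3k-2} = N/D` over `ℚ` with `Ψ_k ∣ D` ("the denominator of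
`H_{3k-2}(x)` contains a … factor of `Ψ_k(x)` which does not cancel with the numerator"; that the
factor is single — Corollary 13 — is the half not addressed here).
[cite: Rechnitzer2006Haruspicy2, Theorem 16] -/
theorem cyclotomic_dvd_denom_sapRowGF_of_thm1_242 (h1 : Rechnitzer2006_thm1)
    (hf1 : Rechnitzer2006_lem25_f1) (h38 : Rechnitzer2006_eq38) (h20 : Rechnitzer2006_lem20)
    {k : ℕ} (hk : 1 ≤ k) (hk2 : k ≠ 2) :
    ∃ N D : ℚ[X], IsCoprime N D ∧ (D : PowerSeries ℚ) * sapRowGF ℚ (3 * k - 2) = N ∧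
      Polynomial.cyclotomic k ℚ ∣ D := by
  classical
  obtain ⟨N₀, s, -, h₀⟩ := h1 (3 * k - 2)
  set D₀ : ℚ[X] := (s.map fun i => Polynomial.cyclotomic i ℚ).prod with hD₀
  have hD₀0 : D₀ ≠ 0 := by
    rw [hD₀, Ne, Multiset.prod_eq_zero_iff, Multiset.mem_map]
    rintro ⟨i, -, hi⟩
    exact Polynomial.cyclotomic_ne_zero i ℚ hi
  have hg : GCDMonoid.gcd N₀ D₀ ≠ 0 := gcd_ne_zero_of_right hD₀0
  have hDg : D₀ = GCDMonoid.gcd N₀ D₀ * (D₀ / GCDMonoid.gcd N₀ D₀) :=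
    (EuclideanDomain.mul_div_cancel' hg (GCDMonoid.gcd_dvd_right N₀ D₀)).symm
  have hNg : N₀ = GCDMonoid.gcd N₀ D₀ * (N₀ / GCDMonoid.gcd N₀ D₀) :=
    (EuclideanDomain.mul_div_cancel' hg (GCDMonoid.gcd_dvd_left N₀ D₀)).symm
  have h' : ((D₀ / GCDMonoid.gcd N₀ D₀ : ℚ[X]) : PowerSeries ℚ) * sapRowGF ℚ (3 * k - 2) =
      (N₀ / GCDMonoid.gcd N₀ D₀ : ℚ[X]) := by
    have hg' : ((GCDMonoid.gcd N₀ D₀ : ℚ[X]) : PowerSeries ℚ) ≠ 0 := by simpa using hg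
    apply mul_left_cancel₀ hg'
    rw [← mul_assoc, ← Polynomial.coe_mul, ← hDg, ← Polynomial.coe_mul, ← hNg, h₀]
  have hξ := Complex.isPrimitiveRoot_exp k (by omega)
  refine ⟨_, _, isCoprime_div_gcd_div_gcd hD₀0, h', cyclotomic_dvd_of_mem_poleSet
    (right_div_gcd_ne_zero hD₀0) h' hk hξ ?_⟩
  rw [map_sapRowGF]
  exact mem_poleSet_sapRowGF_of_242 hf1 h38 h20 hk hk2 hξ

/-- Hence the poles of the rows of `P(x,y)` over `ℂ` contain all roots of unity other than `-1`
(given the 2-4-2 facts). [cite: Rechnitzer2006Haruspicy2, Corollary 27 (proof)] -/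
theorem primitiveRoots_subset_iUnion_poleSet_of_242 (hf1 : Rechnitzer2006_lem25_f1)
    (h38 : Rechnitzer2006_eq38) (h20 : Rechnitzer2006_lem20) :
    {z : ℂ | ∃ k : ℕ, 1 ≤ k ∧ k ≠ 2 ∧ IsPrimitiveRoot z k} ⊆
      ⋃ n, poleSet (coeff n (sapAnisotropicGF ℂ)) := by
  rintro ζ ⟨k, hk, hk2, hζ⟩
  refine Set.mem_iUnion.mpr ⟨3 * k - 2, ?_⟩
  rw [coeff_sapAnisotropicGF]
  exact mem_poleSet_sapRowGF_of_242 hf1 h38 h20 hk hk2 hζ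

/-- **Corollary 27 (the barrier) from Theorem 1 and the 2-4-2 facts.** With the rows rational
(Theorem 1), Theorem 15 (`Rechnitzer2006_thm15_holds`) bounds the accumulation points of the
poles of the rows of a D-finite series, while by `primitiveRoots_subset_iUnion_poleSet_of_242`
they contain every root of unity but `-1`, which accumulate at infinitely many points
(`infinite_derivedSet_primitiveRoots`). So `SAPAnisotropicNotDFinite` rests on
`Rechnitzer2006_thm1`, `Rechnitzer2006_lem20` (haruspicy, §2), `Rechnitzer2006_lem25_f1`
(rectangles) and `Rechnitzer2006_eq38` (the 2-4-2 recurrence, §3.3), with Theorem 15, Lemma 26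
and §3.4 machine-checked. [cite: Rechnitzer2006Haruspicy2, Corollary 27] -/
theorem sapAnisotropicNotDFinite_of_thm1_242 (h1 : Rechnitzer2006_thm1)
    (hf1 : Rechnitzer2006_lem25_f1) (h38 : Rechnitzer2006_eq38) (h20 : Rechnitzer2006_lem20) :
    SAPAnisotropicNotDFinite := by
  intro hDF
  have hfin := Rechnitzer2006_thm15_holds (sapAnisotropicGF ℂ) hDF fun n => by
    rw [coeff_sapAnisotropicGF]
    exact isRationalSeries_sapRowGF h1 n
  exact infinite_derivedSet_primitiveRoots.mono
    (derivedSet_mono _ _ (primitiveRoots_subset_iUnion_poleSet_of_242 hf1 h38 h20)) hfin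

end Literature.Barriers.CriticalPhenomena
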